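import Literature.MathematicalPhysics.QuantumFieldTheory.CubicalCochainsBoxTwo
import Literature.MathematicalPhysics.QuantumFieldTheory.CubicalChainsHodge
import HarnessLib

/-!
# Cubical cochains on `ℤ^d`: the Poincaré lemma in degree three on a box (3-cochains closed on the
# 4-cells of a box are coboundaries of 2-cochains of the box)

Companion of `CubicalCochainsBox.lean` / `CubicalCochainsBoxTwo.lean` (namespace
`…QuantumFieldTheory.LatticeForm`), and support file for the Coulomb-gas (monopole) representation
of the four-dimensional `U(1)` theory with Villain action (proof programme of the named fact
`Literature.MathematicalPhysics.QuantumFieldTheory.FrohlichSpencerU1PerimeterLawD4` and of its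
corollary `Literature.Barriers.QuantumFields.AbelianDeconfinementD4`). In the dual (monopole-gas)
form of the Villain model on a box `Λ` (FS82 §2.4–2.6) the summation variable is the flux
`q = dm` of an integer plaquette field `m` through the cubes of `Λ`; the range of `m ↦ dm` — over
`ℤ` as well as over `ℝ` — is exactly the set of 3-cochains `q` of the box with `dq = 0` on its
4-cells, by the RELATIVE Poincaré lemma in degree three proved here (same recursive primitive as
in degree two, one degree up):

* `boxPrim₃ Q a k` — integrate the axes `0, …, k-1` in turn, in the axial gauge along the axis
  being integrated (`ω(x; i, κ) = 0`), adding to the lower components the column sums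
  `∑_{a_κ ≤ t < x_κ} Q((x, x_κ := t); i, j, κ)`;
* `exists_d₂_eq_of_closed_on_box₃` (**relative Poincaré lemma in degree three**): if
  `cd₃ Q (x; i, j, k, l) = 0` for every 4-cell of the box (`x`, `x + eᵢ + eⱼ + e_k + e_l ∈ [a, b]`,
  `i < j < k < l`), then `d₂ (boxPrim₃ Q a d) (x; i, j, k) = Q (x; i, j, k)` for every cube of the box
  (`x`, `x + eᵢ + eⱼ + e_k ∈ [a, b]`, `i < j < k`); and the primitive is comb-normalised
  (`boxPrim₃_comb`: `ω(x; i, j) = 0` if `i < j` and `x_m = a_m` for all `m > j`).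

Everything is proved; no named fact is introduced.

## References

* J. Fröhlich, T. Spencer, Comm. Math. Phys. 83 (1982) 411–454, §2.3 Lemma 1, §2.4 (2.21)–(2.24),
  §2.6 (2.43)–(2.44) (only closed charge densities survive). [FrohlichSpencerCMP1982]
* M. P. Forsström, J. Lenells, F. Viklund, Ann. Inst. H. Poincaré Probab. Stat. 58 (2022), §2
  (Lemma 2.2, Poincaré lemmas on boxes). [ForsstromLenellsViklund2022]
-/

noncomputable section

open Finset Function

namespace Literature.MathematicalPhysics.QuantumFieldTheory

namespace LatticeForm

open Literature.Probability.LatticeModels (Site)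
open LatticeChain (cd₃)

variable {d : ℕ} {A : Type*} [AddCommGroup A]

/-! ### The recursive primitive -/

/-- **The recursive primitive of a 3-cochain.** `boxPrim₃ Q a (k+1)`: on the pairs of lower axes
`i, j < k`, the stage-`k` primitive at the projected point `(x, x_k := a_k)` plus the column sum
`∑_{a_k ≤ t < x_k} Q((x, x_k := t); i, j, k)`; zero on pairs involving the axis `k` or higher.
[folklore] -/
def boxPrim₃ (Q : Site d → Fin d → Fin d → Fin d → A) (a : Site d) : ℕ → Site d → Fin d → Fin d → A
  | 0 => fun _ _ _ => 0
  | k + 1 => fun x i j =>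
    if h : k < d then
      (if i.val < k ∧ j.val < k then
        boxPrim₃ Q a k (update x ⟨k, h⟩ (a ⟨k, h⟩)) i j +
          axisPrim (fun y => Q y i j ⟨k, h⟩) ⟨k, h⟩ (a ⟨k, h⟩) x
      else 0)
    else boxPrim₃ Q a k x i j

/-- **The primitive is comb-normalised**: `ω(x; i, j) = 0` whenever `x_m = a_m` for all `m > j`
and `i ≤ j`... precisely for all `m` exceeding both indices. [folklore] -/
theorem boxPrim₃_comb (Q : Site d → Fin d → Fin d → Fin d → A) (a : Site d) :
    ∀ (k : ℕ), k ≤ d → ∀ (x : Site d) (i j : Fin d),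
      (∀ m : Fin d, i.val < m.val → j.val < m.val → x m = a m) → boxPrim₃ Q a k x i j = 0
  | 0, _, _, _, _, _ => rfl
  | k + 1, hk, x, i, j, hx => by
    have hkd : k < d := by omega
    simp only [boxPrim₃, dif_pos hkd]
    by_cases hij : i.val < k ∧ j.val < k
    · rw [if_pos hij]
      have hxk : x ⟨k, hkd⟩ = a ⟨k, hkd⟩ := hx ⟨k, hkd⟩ hij.1 hij.2
      rw [axisPrim_eq_zero_of_le _ _ _ (by rw [hxk]), add_zero]
      have : update x ⟨k, hkd⟩ (a ⟨k, hkd⟩) = x := by rw [← hxk, update_eq_self]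
      rw [this]
      exact boxPrim₃_comb Q a k hkd.le x i j hx
    · rw [if_neg hij]

/-! ### The relative Poincaré lemma in degree three -/

/-- **Relative Poincaré lemma in degree three on a box.** If the 3-cochain `Q` is closed on the
4-cells of the box `[a, b]` — `cd₃ Q (x; i, j, k, l) = 0` whenever `x` and `x + eᵢ + eⱼ + e_k + e_l`
lie in the box and `i < j < k < l` — then `ω = boxPrim₃ Q a d` satisfies
`d₂ ω (x; i, j, k) = Q (x; i, j, k)` for every cube of the box (`x`, `x + eᵢ + eⱼ + e_k ∈ [a, b]`,
`i < j < k`). (The fluxes of the integer plaquette fields of the Villain model on a box are exactly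
the closed integer 3-cochains of the box.) [cite: FrohlichSpencerCMP1982, §2.3 Lemma 1, §2.6 (2.43)–(2.44); ForsstromLenellsViklund2022 §2 Lemma 2.2] -/
theorem exists_d₂_eq_of_closed_on_box₃ (Q : Site d → Fin d → Fin d → Fin d → A) (a b : Site d)
    (hcl : ∀ (x : Site d) (i j k l : Fin d), i.val < j.val → j.val < k.val → k.val < l.val →
      x ∈ Set.Icc a b → x + e i + e j + e k + e l ∈ Set.Icc a b → cd₃ Q x i j k l = 0) :
    ∀ (x : Site d) (i j k : Fin d), i.val < j.val → j.val < k.val → x ∈ Set.Icc a b →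
      x + e i + e j + e k ∈ Set.Icc a b → d₂ (boxPrim₃ Q a d) x i j k = Q x i j k := by
  classical
  have key : ∀ s : ℕ, s ≤ d → ∀ (x : Site d), x ∈ Set.Icc a b →
      (∀ m : Fin d, s ≤ m.val → x m = a m) →
      ∀ i j l : Fin d, i.val < j.val → j.val < l.val → l.val < s → x + e i + e j + e l ∈ Set.Icc a b →
        d₂ (boxPrim₃ Q a s) x i j l = Q x i j l := by
    intro s
    induction s with
    | zero => intro _ x _ _ i j l _ _ hl; exact absurd hl (Nat.not_lt_zero _)
    | succ k ih =>
      intro hk x hx hreset i j l hij hjl hlk hxijl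
      have hkd : k < d := by omega
      set κ : Fin d := ⟨k, hkd⟩ with hκ
      have hik : i.val < k := by omega
      have hjk : j.val < k := by omega
      have hiκ : i ≠ κ := fun h => by rw [h] at hik; simp [hκ] at hik
      have hjκ : j ≠ κ := fun h => by rw [h] at hjk; simp [hκ] at hjk
      have hijne : i ≠ j := fun h => by rw [h] at hij; exact lt_irrefl _ hij
      have hres' : ∀ m : Fin d, k ≤ m.val → m ≠ κ → x m = a m := fun m hm hne =>
        hreset m (by
          have : m.val ≠ k := fun h => hne (Fin.ext h)
          omega)
      have hxκ := ((mem_Icc_iff_inBoxAway κ).1 hx).1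
      have hπmem : update x κ (a κ) ∈ Set.Icc a b :=
        update_mem_Icc_of_mem hx κ ⟨le_rfl, hxκ.1.trans hxκ.2⟩
      have hπreset : ∀ m : Fin d, k ≤ m.val → update x κ (a κ) m = a m := by
        intro m hm
        by_cases hmκ : m = κ
        · subst hmκ; exact update_self ..
        · rw [update_of_ne hmκ]; exact hres' m hm hmκ
      -- values of `θ = boxPrim₃ Q a (k+1)`
      have hθ : ∀ (y : Site d) (m m' : Fin d), m.val < k → m'.val < k →
          boxPrim₃ Q a (k + 1) y m m' =
            boxPrim₃ Q a k (update y κ (a κ)) m m' + axisPrim (fun z => Q z m m' κ) κ (a κ) y := by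
        intro y m m' hm hm'
        rw [hκ]
        simp only [boxPrim₃, dif_pos hkd, if_pos (And.intro hm hm')]
      have hθκ₂ : ∀ (y : Site d) (m : Fin d), boxPrim₃ Q a (k + 1) y m κ = 0 := fun y m => by
        rw [hκ]
        simp only [boxPrim₃, dif_pos hkd]
        rw [if_neg (fun h => lt_irrefl k h.2)]
      rcases Nat.lt_or_ge l.val k with hlk' | hlk'
      · -- all three axes already integrated: `i < j < l < k`
        have hlκ : l ≠ κ := fun h => by rw [h] at hlk'; simp [hκ] at hlk'
        simp only [d₂]
        rw [hθ (x + e i) j l hjk hlk', hθ x j l hjk hlk', hθ (x + e j) i l hik hlk', hθ x i l hik hlk',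
          hθ (x + e l) i j hik hjk, hθ x i j hik hjk,
          update_add_single_of_ne x hiκ, update_add_single_of_ne x hjκ, update_add_single_of_ne x hlκ]
        -- the stage-`k` primitive on the floor
        have h1 : boxPrim₃ Q a k (update x κ (a κ) + e i) j l - boxPrim₃ Q a k (update x κ (a κ)) j l -
            (boxPrim₃ Q a k (update x κ (a κ) + e j) i l - boxPrim₃ Q a k (update x κ (a κ)) i l) +
            (boxPrim₃ Q a k (update x κ (a κ) + e l) i j - boxPrim₃ Q a k (update x κ (a κ)) i j) =
            Q (update x κ (a κ)) i j l := by
          have := ih hkd.le (update x κ (a κ)) hπmem hπreset i j l hij hjl hlk' (by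
            rw [← update_add_single_of_ne x hiκ, ← update_add_single_of_ne (x + e i) hjκ,
              ← update_add_single_of_ne (x + e i + e j) hlκ]
            refine update_mem_Icc_of_mem hxijl κ ⟨le_rfl, ?_⟩
            have := ((mem_Icc_iff_inBoxAway κ).1 hxijl).1.2
            rw [add_single_apply_of_ne _ (Ne.symm hlκ), add_single_apply_of_ne _ (Ne.symm hjκ),
              add_single_apply_of_ne _ (Ne.symm hiκ)] at this
            exact hxκ.1.trans (by omega))
          simpa only [d₂] using this
        -- the column sums telescope by closedness on the 4-cells `(z_n; i, j, l, κ)`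
        have h2 : axisPrim (fun z => Q z j l κ) κ (a κ) (x + e i) - axisPrim (fun z => Q z j l κ) κ (a κ) x -
            (axisPrim (fun z => Q z i l κ) κ (a κ) (x + e j) - axisPrim (fun z => Q z i l κ) κ (a κ) x) +
            (axisPrim (fun z => Q z i j κ) κ (a κ) (x + e l) - axisPrim (fun z => Q z i j κ) κ (a κ) x) =
            Q x i j l - Q (update x κ (a κ)) i j l := by
          simp only [axisPrim, add_single_apply_of_ne x (Ne.symm hiκ), add_single_apply_of_ne x (Ne.symm hjκ),
            add_single_apply_of_ne x (Ne.symm hlκ),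
            axisSum_add_single_of_ne _ hiκ, axisSum_add_single_of_ne _ hjκ, axisSum_add_single_of_ne _ hlκ]
          simp only [axisSum, ← Finset.sum_add_distrib, ← Finset.sum_sub_distrib]
          have hstep : ∀ n ∈ Finset.range (x κ - a κ).toNat,
              Q (update x κ (a κ + n) + e i) j l κ - Q (update x κ (a κ + n)) j l κ -
                  (Q (update x κ (a κ + n) + e j) i l κ - Q (update x κ (a κ + n)) i l κ) +
                  (Q (update x κ (a κ + n) + e l) i j κ - Q (update x κ (a κ + n)) i j κ) =
                Q (update x κ (a κ + (n + 1 : ℕ))) i j l - Q (update x κ (a κ + n)) i j l := by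
            intro n hn
            have hn' : (n : ℤ) < (x κ - a κ).toNat := by exact_mod_cast Finset.mem_range.1 hn
            have hzmem : update x κ (a κ + n) ∈ Set.Icc a b :=
              update_mem_Icc_of_mem hx κ ⟨by omega, by omega⟩
            have hzmem' : update x κ (a κ + n) + e i + e j + e l + e κ ∈ Set.Icc a b := by
              rw [add_right_comm _ (e l) (e κ), add_right_comm _ (e j) (e κ), add_right_comm _ (e i) (e κ),
                update_add_single_eq, ← update_add_single_of_ne x hiκ, ← update_add_single_of_ne (x + e i) hjκ,
                ← update_add_single_of_ne (x + e i + e j) hlκ]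
              refine update_mem_Icc_of_mem hxijl κ ⟨by omega, ?_⟩
              have := ((mem_Icc_iff_inBoxAway κ).1 hxijl).1.2
              rw [add_single_apply_of_ne _ (Ne.symm hlκ), add_single_apply_of_ne _ (Ne.symm hjκ),
                add_single_apply_of_ne _ (Ne.symm hiκ)] at this
              omega
            have hf := hcl _ i j l κ hij hjl (by simp [hκ]; exact hlk') hzmem hzmem'
            simp only [cd₃] at hf
            rw [update_add_single_eq] at hf
            push_cast
            rw [← add_assoc]
            have : Q (update x κ (a κ + ↑n) + e i) j l κ - Q (update x κ (a κ + ↑n)) j l κ -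
                  (Q (update x κ (a κ + ↑n) + e j) i l κ - Q (update x κ (a κ + ↑n)) i l κ) +
                  (Q (update x κ (a κ + ↑n) + e l) i j κ - Q (update x κ (a κ + ↑n)) i j κ) -
                (Q (update x κ (a κ + ↑n + 1)) i j l - Q (update x κ (a κ + ↑n)) i j l) =
                Q (update x κ (a κ + ↑n) + e i) j l κ - Q (update x κ (a κ + ↑n)) j l κ -
                  (Q (update x κ (a κ + ↑n) + e j) i l κ - Q (update x κ (a κ + ↑n)) i l κ) +
                  (Q (update x κ (a κ + ↑n) + e l) i j κ - Q (update x κ (a κ + ↑n)) i j κ) -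
                  (Q (update x κ (a κ + ↑n + 1)) i j l - Q (update x κ (a κ + ↑n)) i j l) := rfl
            exact sub_eq_zero.1 hf
          rw [Finset.sum_congr rfl hstep,
            Finset.sum_range_sub (f := fun n : ℕ => Q (update x κ (a κ + n)) i j l)]
          have : a κ + (((x κ - a κ).toNat : ℕ) : ℤ) = x κ := by omega
          simp only [this, update_eq_self, Nat.cast_zero, add_zero]
        -- assemble
        have : boxPrim₃ Q a k (update x κ (a κ) + e i) j l + axisPrim (fun z => Q z j l κ) κ (a κ) (x + e i) -
              (boxPrim₃ Q a k (update x κ (a κ)) j l + axisPrim (fun z => Q z j l κ) κ (a κ) x) -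
            (boxPrim₃ Q a k (update x κ (a κ) + e j) i l + axisPrim (fun z => Q z i l κ) κ (a κ) (x + e j) -
              (boxPrim₃ Q a k (update x κ (a κ)) i l + axisPrim (fun z => Q z i l κ) κ (a κ) x)) +
            (boxPrim₃ Q a k (update x κ (a κ) + e l) i j + axisPrim (fun z => Q z i j κ) κ (a κ) (x + e l) -
              (boxPrim₃ Q a k (update x κ (a κ)) i j + axisPrim (fun z => Q z i j κ) κ (a κ) x)) =
            (boxPrim₃ Q a k (update x κ (a κ) + e i) j l - boxPrim₃ Q a k (update x κ (a κ)) j l -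
              (boxPrim₃ Q a k (update x κ (a κ) + e j) i l - boxPrim₃ Q a k (update x κ (a κ)) i l) +
              (boxPrim₃ Q a k (update x κ (a κ) + e l) i j - boxPrim₃ Q a k (update x κ (a κ)) i j)) +
            (axisPrim (fun z => Q z j l κ) κ (a κ) (x + e i) - axisPrim (fun z => Q z j l κ) κ (a κ) x -
              (axisPrim (fun z => Q z i l κ) κ (a κ) (x + e j) - axisPrim (fun z => Q z i l κ) κ (a κ) x) +
              (axisPrim (fun z => Q z i j κ) κ (a κ) (x + e l) - axisPrim (fun z => Q z i j κ) κ (a κ) x)) := by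
          abel
        rw [this, h1, h2]
        abel
      · -- the new axis: `l = κ`
        have hlκ : l = κ := Fin.ext (by simp [hκ]; omega)
        subst hlκ
        simp only [d₂]
        rw [hθκ₂, hθκ₂, hθκ₂, hθκ₂, hθ (x + e κ) i j hik hjk, hθ x i j hik hjk, update_add_single_self]
        have h2 := axisPrim_add_single_sub_of_le (fun z => Q z i j κ) κ (a κ) hxκ.1
        rw [← h2]
        abel
  intro x i j k hij hjk hx hxijk
  exact key d le_rfl x hx (fun m hm => absurd m.2 (by omega)) i j k hij hjk k.2 hxijk

end LatticeForm

end Literature.MathematicalPhysics.QuantumFieldTheory
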